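import Mathlib.NumberTheory.SmoothNumbers
import Literature.Barriers.Parity.SiegelZeroDichotomy
import Literature.NumberTheory.LFunctions.ZeroFreeRegionUpTo
import Literature.NumberTheory.LFunctions.RealCharacterLadderLeaves
import HarnessLib
import Summits.Parity.GeneralizedHardyLittlewood.Theorems.UnboundedSiegelZeros

/-!
# Soundararajan's conjecture over exceptional moduli: a zero of `L(s,χ)` near `1` makes the
# `y`-smooth numbers equidistributed mod `q` down to `q ≤ y^A` (Banks–Shparlinski 2022, Thm 1.4 / Cor 1.5)

Statement layer for the cell `parity-realchar` (SIEGEL INSTRUMENT, deliverable (3): the «illusory world»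
typed), NEW-TOPIC CANDIDATE «exceptional zero ⇒ Soundararajan's conjecture (smooth numbers in
arithmetic progressions to moduli `q ≤ y^A`) over exceptional moduli; hence the `q^{1/A}`-smooth
numbers fill every reduced class mod `q`» (theory's topic-vs-source call pending). Source: W. D. Banks,
I. E. Shparlinski, *On a conjecture of Soundararajan*, Bull. London Math. Soc. 54 (2022) 301–317
[BanksShparlinski2022Soundararajan]; held copy = arXiv:2009.06800 (tex), §1.1 (set-up, Conjecture,
Hypothesis `SC(𝒬)`), §1.2 Theorems 1.1/1.4, Corollaries 1.2/1.3/1.5 and the sentence after Cor 1.5;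
§3.1 Lemmas 3.1–3.2 (Landau–Page, Deuring–Heilbronn as used). Cross-cell: `landau-siegel` HARVEST
P-533/T-313 «(A)-world consequence: a Siegel zero HELPS … not a candidate (0 consumers)» — typed here
for the CONDITIONALS list.

## ERRATUM (2026-08-27, cell `parity-realchar`; director-frontier ruling 2026-08-27T04:41:28Z on the
## referee conflict V188 PASS vs `landau-siegel` REF-C BOUNCE; referee V190; this revision)

The first version of this file (p495459, with the append p495792) typed "`Q_A < q ≤ y^A`" with the
binder `∀ y : ℝ` and NO sign condition on `y`, in `banksShparlinski2022_theorem14` and in the predicate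
`BanksShparlinski2022.SoundHypothesis`. That is STRONGER THAN PRINT through a junk branch of Mathlib's
`Real.rpow`: for `y = −q` and `A = 2` one has `(−q)^2 = q² ≥ q`, so the typed hypothesis `q ≤ y^A` is
met, while `⌊−q⌋₊ = 0` makes `n = 1` the only "`y`-smooth" number, so the asymptotic (1.1) FAILS for
every class once `φ(q) ≥ 2` (`BanksShparlinski2022.not_prediction_of_lt_two` below). Contraposed, the
unprimed fact asserts a UNIFORM zero-free region `Re ρ ≤ 1 − 1/(Q log(q(|γ|+3)))` for every Dirichlet
character modulo every `q > Q` — an open «no exceptional zero» statement — and in particular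
`¬UnboundedSiegelZeros` (`zeroFree_of_theorem14`, `not_unboundedSiegelZeros_of_theorem14` below =
the referee probe `probe-p495459-negative-y.lean`, kernel-checked); likewise the unprimed `SoundHypothesis 𝒬`
is refutable for every unbounded `𝒬` (`not_soundHypothesis_of_unbounded`), although the source PROVES
`SC(𝒬)` for the infinite sets of Corollaries 1.2 and 1.5. The source never claims any of this: in it
`y` is the smoothness parameter of `P(n) ≤ y` (a positive real; §2.2 "Initial discussion", the
paragraph after the definition of `u = log x/log y`, `v = log x/log q`, held arXiv:2009.06800: "We
remark that, in this section and the next, `y` is sometimes required to exceed a large number that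
might depend on `A`. However, in view of [the standing assumption `Q_A < q ≤ y^A, (a,q) = 1, q ∈ 𝒬` of
Hypothesis `SC(𝒬,A)`, §1.2], we can begin by taking `Q_A` large enough to guarantee that `y` meets
these requirements" — for `y > 0`, `y^A ≥ q > Q_A` forces `y > Q_A^{1/A}`, so every largeness
requirement on `y` is absorbed by `Q_A`; only the sign is not).

**Repair (this revision, misstatement protocol — nothing renamed, no body changed):**
* the faithful statements are the PRIMED declarations `banksShparlinski2022_theorem14'` and
  `BanksShparlinski2022.SoundHypothesis'`, identical to the unprimed ones except for the extra binder
  `0 < y` (referee V190: "`0 < y` suffices — `0 < y ∧ q ≤ y^A ∧ q ≥ 3 ⟹ y > 1` forced; Siegel triggers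
  instantiate `y = q^{1/A} > 0`"); cite print as the primed names;
* every consumer is re-proved over the primed fact under the same name with a prime
  (`corollary15_of_theorem14'`, `prediction_of_isSiegelZero'`, `exists_smooth_in_class_of_isSiegelZero'`,
  `exists_smooth_in_class_frequently_of_unboundedSiegelZeros'`), each with the binder `0 < y`;
* the unprimed `banksShparlinski2022_theorem14` and `SoundHypothesis` KEEP their bodies (their in-file
  consumers stay valid Lean, and `banksShparlinski2022_theorem14 → banksShparlinski2022_theorem14'` is
  `theorem14'_of_theorem14`) but are re-tagged as a CLAIM asserted by no source, with this paragraph as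
  the reason; the junk branch is exhibited in the kernel (§ ERRATUM witnesses below) so that no audit has
  to re-derive it. Nothing else in the file changes (definitions `smoothCountAP`, `smoothCountCoprime`,
  `Prediction`; `one_le_smoothCountCoprime`, `exists_smooth_in_class` are sign-independent).

## What the source prints (§1.1–§1.2)

"`P(n)` the largest prime factor … `P(1) := 1`. A number `n` is said to be `y`-smooth if … `P(n) ≤ y`.
`𝒮(x,y) := 𝒮(y) ∩ [1,x]` … `Ψ(x,y)` [its] cardinality … `Ψ(x,y;q,a) := ∑_{n ∈ 𝒮(x,y), n ≡ a mod q} 1`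
and `Ψ_q(x,y) := ∑_{n ∈ 𝒮(x,y), (n,q)=1} 1`; it is expected that the asymptotic relation
(1.1) `Ψ(x,y;q,a) ∼ Ψ_q(x,y)/φ(q)` holds … under the condition `(a,q) = 1`."
**Conjecture (Soundararajan).** "For any fixed value of `A > 0`, if `q` is sufficiently large (depending
only on `A`) with `q ≤ y^A` and `(a,q) = 1`, then (1.1) holds as `log x/log q → ∞`." (Granville: `A < 1`;
Soundararajan + Harper: all `A < 4√e`; "the proof for arbitrarily large values of `A` must lie fairly
deep, for it implies Vinogradov's conjecture that the least quadratic nonresidue modulo `p` is of size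
`p^{o(1)}`.") **Hypothesis `SC(𝒬)`.** "Let `𝒬 ⊆ ℕ`. For every fixed `A > 0`, if `q` is sufficiently
large (depending only on `A`) with `q ≤ y^A`, `(a,q) = 1`, `q ∈ 𝒬`, then (1.1) holds as
`log x/log q → ∞`." ("Soundararajan's Conjecture holds over `𝒬` whenever `SC(𝒬)` is true.")
**Theorem 1.4.** "For every fixed value of `A > 0`, there is a number `Q_A > 0` (depending only on `A`)
for which the following holds. If `Q_A < q ≤ y^A`, `(a,q) = 1`, and there is a character `χ` modulo `q`
such that `L(s,χ)` has a zero `β + iγ` of `L(s,χ)` satisfying `β > 1 − Q_A^{−1}/log q(|γ| + 3)`, then the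
asymptotic relation (1.1) holds as `log x/log q → ∞`."
**Corollary 1.5.** "Let `𝒬` be a set of natural numbers such that, for every `q ∈ 𝒬`, there is a
character `χ` modulo `q` and a real zero `β_q` of `L(s,χ)` satisfying `(1 − β_q) log q = o(1)`
(`q → ∞`, `q ∈ 𝒬`). Then Soundararajan's Conjecture holds over `𝒬`." "In particular, Corollary 1.5
shows that any future work on Soundararajan's Conjecture (over `ℕ`) can assume that Siegel zeros do not
exist." (Remark: ERH ⇒ the Conjecture. Proof of 1.4: Harper's argument + the Deuring–Heilbronn
phenomenon, §3.)

## Typing notes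

* `y`-smooth (`P(n) ≤ y`, `y` real) = Mathlib's `n ∈ Nat.smoothNumbers (⌊y⌋₊ + 1)` (all prime factors
  `< ⌊y⌋ + 1`; `0` excluded); `Ψ(x,y;q,a)`, `Ψ_q(x,y)` are finite cardinalities over `1 ≤ n ≤ ⌊x⌋`.
* **"(1.1) holds as `log x/log q → ∞`".** Rendered POINTWISE in the modulus data: for the given
  `(q, y, a)`, `∀ ε > 0 ∃ x₀ ∀ x ≥ x₀ : |Ψ(x,y;q,a) − Ψ_q(x,y)/φ(q)| ≤ ε·Ψ_q(x,y)/φ(q)`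
  (`BanksShparlinski2022.Prediction y q a`). Any uniformity in `(q,y,a)` that the print intends is
  DROPPED — the weaker (safe) reading; it is still far from trivial (for fixed `y = q^{1/A}` it forces the
  primes `≤ y` to generate `(ℤ/qℤ)ˣ`, cf. `exists_smooth_in_class` below).
* "a zero `β + iγ` of `L(s,χ)`": Mathlib's continued `LFunction`, with `ρ ≠ 1` added to keep the junk
  value of a principal `L`-function at `s = 1` out (a genuine zero is never at `s = 1`);
  "`Q_A^{−1}/log q(|γ|+3)`" read as `1/(Q_A · log(q(|γ|+3)))`.
* `Q_A` "depending only on `A`": `∀ A > 0, ∃ Q_A > 0, …` outermost. The real `y` carries `q ≤ y^A`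
  (`Real.rpow`). ERRATUM 2026-08-27: the first version's gloss "`y > 1` is forced" holds ONLY for
  `y > 0` — for `y < 0` Mathlib's `Real.rpow` returns junk values that need not be small
  (`(−q)^2 = q²`), so the faithful statements carry the explicit binder `0 < y` (primed declarations;
  see § ERRATUM above).
* **S6 vacuity audit.** Theorem 1.4's hypothesis is a zero of quality `> Q_A` (relative to
  `log(q(|γ|+3))`) at a modulus `q > Q_A` — bounded quality, NOT voided by Siegel's (ineffective) theorem;
  Cor 1.5's hypothesis `(1−β_q) log q → 0` along `𝒬` is exactly `UnboundedSiegelZeros`-type and is the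
  column's standing antecedent. Not S6. Effectivity: `Q_A` is not computed in print (Harper's method +
  Deuring–Heilbronn); flag EFF-threshold.

## Contents

* definitions `BanksShparlinski2022.smoothCountAP` (`Ψ(x,y;q,a)`), `smoothCountCoprime` (`Ψ_q(x,y)`),
  `Prediction` ((1.1) as `x → ∞`), `SoundHypothesis' 𝒬` (`SC(𝒬)`, binder `0 < y`; the unprimed
  `SoundHypothesis` is the WITHDRAWN sign-free version, see § ERRATUM);
* `banksShparlinski2022_theorem14'` — NAMED FACT, Theorem 1.4 AS PRINTED (pointwise reading, binder
  `0 < y`); the unprimed `banksShparlinski2022_theorem14` is the WITHDRAWN sign-free version (claim-tagged,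
  body kept; `theorem14'_of_theorem14`);
* ERRATUM witnesses (PROVED): `eq_one_of_mem_smoothNumbers_of_lt_two`, `not_prediction_of_lt_two`
  (`y < 2`, `φ(q) ≥ 2` ⇒ ¬(1.1)), `not_soundHypothesis_of_unbounded`, `zeroFree_of_theorem14`,
  `not_unboundedSiegelZeros_of_theorem14` (the unprimed fact implies a uniform zero-free region, hence
  `¬UnboundedSiegelZeros`), `soundHypothesis'_of_soundHypothesis`;
* PROVED over the PRIMED fact (the consumers of record): `corollary15_of_theorem14'`,
  `prediction_of_isSiegelZero'`, `exists_smooth_in_class_of_isSiegelZero'`,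
  `exists_smooth_in_class_frequently_of_unboundedSiegelZeros'` — same statements as the unprimed
  consumers listed next, with the binder `0 < y`;
* PROVED over the unprimed (withdrawn) fact, kept valid and unchanged:
  `BanksShparlinski2022.corollary15_of_theorem14` (Cor 1.5 DERIVED from Thm 1.4: real zeros
  with `(1−β_q) log q → 0` along `𝒬` ⇒ `SC(𝒬)`), `prediction_of_isSiegelZero` (a Tao–Teräväinen Siegel
  zero of quality `η ≥ 4Q_A` at `q > Q_A`, `q ≥ 3` ⇒ (1.1) for every `y` with `q ≤ y^A` and every reduced
  class), `one_le_smoothCountCoprime` (`Ψ_q(x,y) ≥ 1` for `x ≥ 1`: `n = 1`), `exists_smooth_in_class`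
  ((1.1) ⇒ every such class CONTAINS `y`-smooth numbers: for all large `x`, `Ψ(x,y;q,a) ≥ 1`),
  `exists_smooth_in_class_of_isSiegelZero` — **the illusory-world headline: under a Siegel zero of
  quality `≥ 4Q_A` at `q > Q_A`, for every `y ≥ q^{1/A}` every reduced residue class mod `q` contains a
  `y`-smooth number** (the `y`-smooth numbers generate `(ℤ/qℤ)ˣ` — Vinogradov's phenomenon at the
  exceptional modulus); `exists_smooth_in_class_frequently_of_unboundedSiegelZeros` — under the tree's
  open hypothesis `UnboundedSiegelZeros` this happens at arbitrarily large moduli `q`, for every `A > 0`.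

Index only (not typed): Theorem 1.1 / Corollaries 1.2–1.3 (smooth moduli `P(q)^{Q_A} < q`, positive
density), the ERH remark, Proposition 2.x (Harper's criterion), Lemmas 3.1–3.2.

LABEL: instrument / statement layer («illusory world»). WHAT THIS IS NOT: no claim that an exceptional
zero exists; Soundararajan's Conjecture over `ℕ` remains open beyond `A < 4√e`; nothing here bears on
parity.

## References

* [BanksShparlinski2022Soundararajan] W. D. Banks, I. E. Shparlinski, Bull. London Math. Soc. 54 (2022)
  301–317, doi:10.1112/blms.12524 = arXiv:2009.06800: §1.1–1.2 (Conjecture, Hypothesis SC(𝒬),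
  Theorem 1.4, Corollary 1.5).
* [TaoTeravainen2021] Definition 1.4 (`IsSiegelZero`).
-/

noncomputable section

open Finset Real Filter
open Literature.Barriers.Parity

namespace Literature.NumberTheory.LFunctions

namespace BanksShparlinski2022

/-- `Ψ(x, y; q, a) = #{1 ≤ n ≤ x : P(n) ≤ y, n ≡ a (mod q)}`. [cite: BanksShparlinski2022Soundararajan, §1.1 (definition of Ψ(x,y;q,a))] -/
def smoothCountAP (x y : ℝ) (q : ℕ) (a : ℤ) : ℕ :=
  ((Finset.Icc 1 ⌊x⌋₊).filter
    (fun n : ℕ => n ∈ Nat.smoothNumbers (⌊y⌋₊ + 1) ∧ ((n : ℤ) : ZMod q) = (a : ZMod q))).card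

/-- `Ψ_q(x, y) = #{1 ≤ n ≤ x : P(n) ≤ y, (n, q) = 1}`. [cite: BanksShparlinski2022Soundararajan, §1.1 (definition of Ψ_q(x,y))] -/
def smoothCountCoprime (x y : ℝ) (q : ℕ) : ℕ :=
  ((Finset.Icc 1 ⌊x⌋₊).filter
    (fun n : ℕ => n ∈ Nat.smoothNumbers (⌊y⌋₊ + 1) ∧ Nat.Coprime n q)).card

/-- The PREDICATE «(1.1) holds as `log x/log q → ∞`» for the modulus data `(q, y, a)` (pointwise
reading): `Ψ(x,y;q,a) ∼ Ψ_q(x,y)/φ(q)` as `x → ∞`, i.e. for every `ε > 0` eventually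
`|Ψ(x,y;q,a) − Ψ_q(x,y)/φ(q)| ≤ ε·Ψ_q(x,y)/φ(q)`. A predicate with parameters (the asymptotic relation
the source's theorems assert for particular `(q,y,a)`), not a statement.
[cite: BanksShparlinski2022Soundararajan, §1.1 (1.1)] -/
def Prediction (y : ℝ) (q : ℕ) (a : ℤ) : Prop :=
  ∀ ε : ℝ, 0 < ε → ∃ x₀ : ℝ, ∀ x : ℝ, x₀ ≤ x →
    |(smoothCountAP x y q a : ℝ) - smoothCountCoprime x y q / (Nat.totient q : ℝ)| ≤
      ε * (smoothCountCoprime x y q / (Nat.totient q : ℝ))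

/-- **WITHDRAWN sign-free version of «Hypothesis `SC(𝒬)`» (ERRATUM 2026-08-27; the faithful predicate
is `SoundHypothesis'`).** This body quantifies `∀ y : ℝ` with `q ≤ y^A` and no sign condition; through
Mathlib's `Real.rpow` junk branch (`(−q)^2 = q² ≥ q`, `⌊−q⌋₊ = 0`) it demands (1.1) for "`y = −q`",
where only `n = 1` is smooth and (1.1) fails for `φ(q) ≥ 2` — so, unlike the source's `SC(𝒬)` (which
the source PROVES for the infinite sets of Corollaries 1.2 and 1.5), this predicate is FALSE for every
unbounded `𝒬` (`not_soundHypothesis_of_unbounded`). Kept with its body because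
`corollary15_of_theorem14` concludes it; asserted for no `𝒬` by any source. Informal content otherwise
as printed: for every fixed `A > 0`, if `q ∈ 𝒬` is sufficiently large (depending only on `A`) with
`q ≤ y^A` and `(a,q) = 1`, then (1.1) holds.
[claim: BanksShparlinski2022Soundararajan, status: disputed] -/
def SoundHypothesis (𝒬 : Set ℕ) : Prop :=
  ∀ A : ℝ, 0 < A → ∃ Q₀ : ℝ, ∀ q : ℕ, q ∈ 𝒬 → Q₀ < q →
    ∀ y : ℝ, (q : ℝ) ≤ y ^ A → ∀ a : ℤ, Int.gcd a q = 1 → Prediction y q a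

/-- The PREDICATE «Hypothesis `SC(𝒬)`» of the source (Soundararajan's asymptotic over the moduli in
`𝒬`), faithful form (ERRATUM 2026-08-27: binder `0 < y` — `y` is the smoothness parameter of
`P(n) ≤ y`, a positive real in the source): for every fixed `A > 0`, if `q ∈ 𝒬` is sufficiently large
(depending only on `A`) with `q ≤ y^A` (`y > 0`) and `(a,q) = 1`, then (1.1) holds (pointwise reading of
"as `log x/log q → ∞`", see the module docstring). A predicate in the set `𝒬` (for `𝒬 = ℕ` it is
the statement Soundararajan proposed — proved by Harper for `A < 4√e`, unproved in general; the source
PROVES it for the sets of Corollaries 1.2 and 1.5 — see `corollary15_of_theorem14'`); nothing here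
asserts it for any particular `𝒬`.
[cite: BanksShparlinski2022Soundararajan, §1.1 Hypothesis SC(𝒬)] -/
def SoundHypothesis' (𝒬 : Set ℕ) : Prop :=
  ∀ A : ℝ, 0 < A → ∃ Q₀ : ℝ, ∀ q : ℕ, q ∈ 𝒬 → Q₀ < q →
    ∀ y : ℝ, 0 < y → (q : ℝ) ≤ y ^ A → ∀ a : ℤ, Int.gcd a q = 1 → Prediction y q a

/-- The withdrawn sign-free predicate implies the faithful one (it only drops the binder `0 < y`).
[cite: BanksShparlinski2022Soundararajan, §1.1 Hypothesis SC(𝒬)] -/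
theorem soundHypothesis'_of_soundHypothesis {𝒬 : Set ℕ} (h : SoundHypothesis 𝒬) :
    SoundHypothesis' 𝒬 := by
  intro A hA
  obtain ⟨Q₀, H⟩ := h A hA
  exact ⟨Q₀, fun q hq𝒬 hq y _ hy a ha => H q hq𝒬 hq y hy a ha⟩

end BanksShparlinski2022

open BanksShparlinski2022

/-- **WITHDRAWN sign-free transcription of Banks–Shparlinski 2022, Theorem 1.4 (ERRATUM 2026-08-27; the
statement of record is `banksShparlinski2022_theorem14'`).** This body quantifies `∀ y : ℝ` with
`q ≤ y^A` and NO sign condition on `y`. Through Mathlib's `Real.rpow` junk branch — `(−q)^2 = q² ≥ q`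
while `⌊−q⌋₊ = 0` leaves `n = 1` as the only "`y`-smooth" number, so (1.1) fails once `φ(q) ≥ 2`
(`BanksShparlinski2022.not_prediction_of_lt_two`) — it asserts, contraposed, a UNIFORM zero-free region
`Re ρ ≤ 1 − 1/(Q log(q(|γ|+3)))` for every character modulo every `q > Q` and hence
`¬UnboundedSiegelZeros` (`BanksShparlinski2022.zeroFree_of_theorem14`,
`BanksShparlinski2022.not_unboundedSiegelZeros_of_theorem14`): an open «no exceptional zero» statement
that the source does not claim (director-frontier ruling 2026-08-27T04:41:28Z on referee probe
`probe-p495459-negative-y.lean`; referee V190). STRONGER THAN PRINT, asserted by no source — tagged as a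
claim, not a cite; the body is kept unchanged so that its in-file consumers remain valid Lean
(`theorem14'_of_theorem14` records that it implies the statement of record). Informal content otherwise
as printed: for every `A > 0` there is `Q_A > 0` such that if `Q_A < q ≤ y^A`, `(a,q) = 1`, and some
`L(s,χ)`, `χ` mod `q`, has a zero `ρ = β + iγ` with `β > 1 − 1/(Q_A log(q(|γ|+3)))`, then
`Ψ(x,y;q,a) ∼ Ψ_q(x,y)/φ(q)`. [claim: BanksShparlinski2022Soundararajan, status: disputed] -/
def banksShparlinski2022_theorem14 : Prop :=
  ∀ A : ℝ, 0 < A → ∃ Q : ℝ, 0 < Q ∧ ∀ (q : ℕ) [NeZero q], Q < q →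
    ∀ y : ℝ, (q : ℝ) ≤ y ^ A → ∀ a : ℤ, Int.gcd a q = 1 →
      (∃ (χ : DirichletCharacter ℂ q) (ρ : ℂ), ρ ≠ 1 ∧ χ.LFunction ρ = 0 ∧
          1 - 1 / (Q * Real.log ((q : ℝ) * (|ρ.im| + 3))) < ρ.re) →
        Prediction y q a

/-- **Banks–Shparlinski 2022, Theorem 1.4** (NAMED FACT of record, AS PRINTED with the pointwise reading
of "(1.1) holds as `log x/log q → ∞`"; `ρ ≠ 1` added against Mathlib's junk value at `s = 1`; ERRATUM
2026-08-27: binder `0 < y` — `y` is the smoothness parameter of `P(n) ≤ y`, a positive real in the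
source, cf. §2.2 "we can begin by taking `Q_A` large enough to guarantee that `y` meets these
requirements"): "For every fixed value of `A > 0`, there is a number `Q_A > 0` (depending only on `A`)
for which the following holds. If `Q_A < q ≤ y^A`, `(a,q) = 1`, and there is a character `χ` modulo `q`
such that `L(s,χ)` has a zero `β + iγ` of `L(s,χ)` satisfying `β > 1 − Q_A^{−1}/log q(|γ| + 3)`, then the
asymptotic relation (1.1) [`Ψ(x,y;q,a) ∼ Ψ_q(x,y)/φ(q)`] holds as `log x/log q → ∞`." Not proved here
(Harper's argument plus the Deuring–Heilbronn phenomenon, §§2–3 of the source); `Q_A` not computed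
(EFF-threshold). For `y > 0` the hypotheses force `y > Q_A^{1/A}` (in particular `y > 1` once
`Q_A ≥ 1`), so every largeness requirement on `y` is carried by the existential `Q_A`, as in the source.
[cite: BanksShparlinski2022Soundararajan, §1.2 Theorem 1.4] -/
def banksShparlinski2022_theorem14' : Prop :=
  ∀ A : ℝ, 0 < A → ∃ Q : ℝ, 0 < Q ∧ ∀ (q : ℕ) [NeZero q], Q < q →
    ∀ y : ℝ, 0 < y → (q : ℝ) ≤ y ^ A → ∀ a : ℤ, Int.gcd a q = 1 →
      (∃ (χ : DirichletCharacter ℂ q) (ρ : ℂ), ρ ≠ 1 ∧ χ.LFunction ρ = 0 ∧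
          1 - 1 / (Q * Real.log ((q : ℝ) * (|ρ.im| + 3))) < ρ.re) →
        Prediction y q a

namespace BanksShparlinski2022

/-- The withdrawn sign-free transcription implies the statement of record (it only drops the binder
`0 < y`); recorded so that audits see the direction of the erratum.
[cite: BanksShparlinski2022Soundararajan, §1.2 Theorem 1.4] -/
theorem theorem14'_of_theorem14 (h14 : banksShparlinski2022_theorem14) :
    banksShparlinski2022_theorem14' := by
  intro A hA
  obtain ⟨Q, hQ, H⟩ := h14 A hA
  exact ⟨Q, hQ, fun q _ hq y _ hy a ha hz => H q hq y hy a ha hz⟩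

/-- **Corollary 1.5, DERIVED from Theorem 1.4** — over the WITHDRAWN sign-free transcription (ERRATUM
2026-08-27: the derivation of record is `corollary15_of_theorem14'`, concluding `SoundHypothesis'`; this
one is kept valid and unchanged). If along `𝒬` each `q` carries a character `χ_q` with
a real zero `β_q < 1`, and `(1 − β_q) log q → 0` (`q → ∞`, `q ∈ 𝒬`; rendered `∀ δ > 0, ∃ q₁, ∀ q ∈ 𝒬,
q ≥ q₁ → (1 − β_q) log q ≤ δ`), then `SC(𝒬)` holds (Soundararajan's asymptotic over `𝒬`). (For `q ≥ max(Q_A, q₁, 3)`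
with `δ = 1/(4Q_A)`: `1 − β_q ≤ δ/log q < 1/(Q_A log 3q)` since `log 3q ≤ 2 log q`.)
[cite: BanksShparlinski2022Soundararajan, §1.2 Corollary 1.5] -/
theorem corollary15_of_theorem14 (h14 : banksShparlinski2022_theorem14) (𝒬 : Set ℕ)
    (χ : ∀ q : ℕ, DirichletCharacter ℂ q) (β : ℕ → ℝ)
    (hzero : ∀ q ∈ 𝒬, ∀ _ : NeZero q, β q < 1 ∧ (χ q).LFunction (β q : ℂ) = 0)
    (hsmall : ∀ δ : ℝ, 0 < δ → ∃ q₁ : ℕ, ∀ q ∈ 𝒬, q₁ ≤ q → (1 - β q) * Real.log q ≤ δ) :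
    SoundHypothesis 𝒬 := by
  intro A hA
  obtain ⟨Q, hQ, H⟩ := h14 A hA
  obtain ⟨q₁, hq₁⟩ := hsmall (1 / (4 * Q)) (by positivity)
  refine ⟨max Q (max (q₁ : ℝ) 3), fun q hq𝒬 hq y hy a ha => ?_⟩
  have hqQ : Q < q := lt_of_le_of_lt (le_max_left _ _) hq
  have hq1 : (q₁ : ℝ) < q := lt_of_le_of_lt (le_trans (le_max_left _ _) (le_max_right _ _)) hq
  have hq3 : (3 : ℝ) < q := lt_of_le_of_lt (le_trans (le_max_right _ _) (le_max_right _ _)) hq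
  have hq1' : q₁ ≤ q := by exact_mod_cast hq1.le
  haveI : NeZero q := ⟨by rintro rfl; norm_num at hq3⟩
  obtain ⟨hβ1, hz⟩ := hzero q hq𝒬 inferInstance
  have hδ := hq₁ q hq𝒬 hq1'
  refine H q hqQ y hy a ha ⟨χ q, (β q : ℂ), ?_, hz, ?_⟩
  · intro h1
    have := congrArg Complex.re h1
    simp at this
    linarith
  · -- `1 − 1/(Q log(3q)) < β_q`
    simp only [Complex.ofReal_im, abs_zero, zero_add, Complex.ofReal_re]
    have hq0 : (0 : ℝ) < q := by linarith
    have hlogq : 1 < Real.log (q : ℝ) := by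
      have h9 := Real.exp_one_lt_d9
      rw [Real.lt_log_iff_exp_lt hq0]; linarith
    have hlog3q : Real.log ((q : ℝ) * 3) ≤ 2 * Real.log q := by
      rw [Real.log_mul hq0.ne' (by norm_num)]
      have : Real.log (3 : ℝ) ≤ Real.log q := Real.log_le_log (by norm_num) hq3.le
      linarith
    have hlog3q0 : 0 < Real.log ((q : ℝ) * 3) := by
      rw [Real.log_mul hq0.ne' (by norm_num)]
      have : 0 < Real.log (3 : ℝ) := Real.log_pos (by norm_num)
      linarith
    -- from `(1 − β) log q ≤ 1/(4Q)`: `1 − β ≤ 1/(4Q log q) < 1/(Q log 3q)`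
    have h1 : 1 - β q ≤ 1 / (4 * Q) / Real.log q := by
      rw [le_div_iff₀ (by linarith)]; exact hδ
    have h2 : 1 / (4 * Q) / Real.log q < 1 / (Q * Real.log ((q : ℝ) * 3)) := by
      rw [div_div, div_lt_div_iff₀ (by positivity) (by positivity)]
      nlinarith
    linarith

/-- **A Siegel zero of quality `≥ 4Q_A` triggers Theorem 1.4** — over the WITHDRAWN sign-free
transcription (ERRATUM 2026-08-27: statement of record `prediction_of_isSiegelZero'`, binder `0 < y`;
this one is kept valid and unchanged, and with `y = −q` it is the engine of
`not_unboundedSiegelZeros_of_theorem14`). Under the named fact: for every `A > 0`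
there is `Q_A > 0` such that a Tao–Teräväinen Siegel zero of quality `η ≥ 4Q_A` attached to `χ` mod
`q > max(Q_A, 3)` gives (1.1) for every `y` with `q ≤ y^A` and every reduced class `a`.
[cite: BanksShparlinski2022Soundararajan, §1.2 Theorem 1.4] [cite: TaoTeravainen2021, Definition 1.4] -/
theorem prediction_of_isSiegelZero (h14 : banksShparlinski2022_theorem14) {A : ℝ} (hA : 0 < A) :
    ∃ Q : ℝ, 0 < Q ∧ ∀ (q : ℕ) [NeZero q], Q < q → 3 ≤ q →
      ∀ (χ : DirichletCharacter ℂ q) (η : ℝ), IsSiegelZero χ η → 4 * Q ≤ η →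
        ∀ y : ℝ, (q : ℝ) ≤ y ^ A → ∀ a : ℤ, Int.gcd a q = 1 → Prediction y q a := by
  obtain ⟨Q, hQ, H⟩ := h14 A hA
  refine ⟨Q, hQ, fun q _ hqQ hq3 χ η hS hη y hy a ha => ?_⟩
  obtain ⟨hprim, hquad, h10, hzero⟩ := hS
  have hq3r : (3 : ℝ) ≤ q := by exact_mod_cast hq3
  have hq0 : (0 : ℝ) < q := by linarith
  have hlogq : 1 < Real.log (q : ℝ) := by
    have h9 := Real.exp_one_lt_d9
    rw [Real.lt_log_iff_exp_lt hq0]; linarith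
  have hηpos : 0 < η := by linarith
  refine H q hqQ y hy a ha ⟨χ, ((1 - 1 / (η * Real.log q) : ℝ) : ℂ), ?_, hzero, ?_⟩
  · intro h1
    have := congrArg Complex.re h1
    simp only [Complex.ofReal_re, Complex.one_re] at this
    have : 1 / (η * Real.log q) = 0 := by linarith
    rw [div_eq_zero_iff] at this
    rcases this with h | h
    · norm_num at h
    · have : 0 < η * Real.log q := by positivity
      linarith
  · simp only [Complex.ofReal_im, abs_zero, zero_add, Complex.ofReal_re]
    have hlog3q : Real.log ((q : ℝ) * 3) ≤ 2 * Real.log q := by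
      rw [Real.log_mul hq0.ne' (by norm_num)]
      have : Real.log (3 : ℝ) ≤ Real.log q := Real.log_le_log (by norm_num) hq3r
      linarith
    have hlog3q0 : 0 < Real.log ((q : ℝ) * 3) := by
      rw [Real.log_mul hq0.ne' (by norm_num)]
      have : 0 < Real.log (3 : ℝ) := Real.log_pos (by norm_num)
      linarith
    -- `1/(η log q) ≤ 1/(4Q log q) < 1/(Q log 3q)`
    have h1 : 1 / (η * Real.log q) ≤ 1 / (4 * Q * Real.log q) :=
      div_le_div_of_nonneg_left zero_le_one (by positivity)
        (mul_le_mul_of_nonneg_right hη (by linarith))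
    have h2 : 1 / (4 * Q * Real.log q) < 1 / (Q * Real.log ((q : ℝ) * 3)) := by
      rw [div_lt_div_iff₀ (by positivity) (by positivity)]
      nlinarith
    linarith

/-- `Ψ_q(x, y) ≥ 1` for `x ≥ 1` (`n = 1` is `y`-smooth and coprime to `q`).
[cite: BanksShparlinski2022Soundararajan, §1.1 (definition of Ψ_q(x,y))] -/
theorem one_le_smoothCountCoprime {x : ℝ} (hx : 1 ≤ x) (y : ℝ) (q : ℕ) :
    1 ≤ smoothCountCoprime x y q := by
  unfold smoothCountCoprime
  refine Finset.one_le_card.mpr ⟨1, ?_⟩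
  simp only [Finset.mem_filter, Finset.mem_Icc, le_refl, true_and, Nat.coprime_one_left_iff,
    and_true]
  refine ⟨Nat.one_le_floor_iff _ |>.mpr hx, ?_⟩
  rw [Nat.mem_smoothNumbers]
  exact ⟨one_ne_zero, by simp⟩

/-- **(1.1) puts `y`-smooth numbers into the class**: if `Ψ(x,y;q,a) ∼ Ψ_q(x,y)/φ(q)` and `q ≥ 1`, then
for all large `x`, `Ψ(x,y;q,a) ≥ 1` — the class `a mod q` contains a `y`-smooth number (indeed
`Ψ(x,y;q,a) ≥ ½·Ψ_q(x,y)/φ(q) > 0` with `ε = ½`, `Ψ_q ≥ 1`).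
[cite: BanksShparlinski2022Soundararajan, §1.1 (1.1) (with Granville's remark on the least quadratic non-residue)] -/
theorem exists_smooth_in_class {y : ℝ} {q : ℕ} (hq : 0 < q) {a : ℤ} (hP : Prediction y q a) :
    ∃ x₀ : ℝ, ∀ x : ℝ, x₀ ≤ x → 1 ≤ smoothCountAP x y q a := by
  obtain ⟨x₀, hx₀⟩ := hP (1 / 2) (by norm_num)
  refine ⟨max x₀ 1, fun x hx => ?_⟩
  have hx1 : 1 ≤ x := le_trans (le_max_right _ _) hx
  have h := hx₀ x (le_trans (le_max_left _ _) hx)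
  have hφ : (0 : ℝ) < (Nat.totient q : ℝ) := by exact_mod_cast Nat.totient_pos.mpr hq
  have hΨq : (1 : ℝ) ≤ smoothCountCoprime x y q := by
    exact_mod_cast one_le_smoothCountCoprime hx1 y q
  have hM : 0 < (smoothCountCoprime x y q : ℝ) / (Nat.totient q : ℝ) := by positivity
  -- `Ψ ≥ M − M/2 = M/2 > 0`, and `Ψ` is a natural number
  have hlow : (smoothCountCoprime x y q : ℝ) / (Nat.totient q : ℝ) / 2 ≤ (smoothCountAP x y q a : ℝ) := by
    have := (abs_le.mp h).1
    linarith
  have hpos : (0 : ℝ) < (smoothCountAP x y q a : ℝ) := lt_of_lt_of_le (by positivity) hlow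
  exact_mod_cast (show 0 < smoothCountAP x y q a by exact_mod_cast hpos)

/-- **The illusory-world headline** (PROVED modulo the WITHDRAWN sign-free transcription of Theorem 1.4;
ERRATUM 2026-08-27: statement of record `exists_smooth_in_class_of_isSiegelZero'`, binder `0 < y`; this
one is kept valid and unchanged): for every `A > 0` there is `Q_A > 0`
such that, if `χ` mod `q` (`q > Q_A`, `q ≥ 3`) carries a Tao–Teräväinen Siegel zero of quality
`η ≥ 4Q_A`, then for every `y` with `q ≤ y^A` (i.e. `y ≥ q^{1/A}`) EVERY reduced residue class `a mod q`
contains `y`-smooth numbers — the `y`-smooth numbers generate `(ℤ/qℤ)ˣ` (for prime `q` and `A ≥ 2`: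
the least quadratic non-residue is `≤ q^{1/A}`; Vinogradov's phenomenon at the exceptional modulus).
[cite: BanksShparlinski2022Soundararajan, §1.2 Theorem 1.4 and §1.1 (Granville's remark on the least quadratic non-residue)]
[cite: TaoTeravainen2021, Definition 1.4] -/
theorem exists_smooth_in_class_of_isSiegelZero (h14 : banksShparlinski2022_theorem14) {A : ℝ}
    (hA : 0 < A) :
    ∃ Q : ℝ, 0 < Q ∧ ∀ (q : ℕ) [NeZero q], Q < q → 3 ≤ q →
      ∀ (χ : DirichletCharacter ℂ q) (η : ℝ), IsSiegelZero χ η → 4 * Q ≤ η →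
        ∀ y : ℝ, (q : ℝ) ≤ y ^ A → ∀ a : ℤ, Int.gcd a q = 1 →
          ∃ n : ℕ, 1 ≤ n ∧ n ∈ Nat.smoothNumbers (⌊y⌋₊ + 1) ∧ ((n : ℤ) : ZMod q) = (a : ZMod q) := by
  obtain ⟨Q, hQ, H⟩ := prediction_of_isSiegelZero h14 hA
  refine ⟨Q, hQ, fun q _ hqQ hq3 χ η hS hη y hy a ha => ?_⟩
  have hP := H q hqQ hq3 χ η hS hη y hy a ha
  obtain ⟨x₀, hx₀⟩ := exists_smooth_in_class (by omega) hP
  have h1 := hx₀ x₀ le_rfl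
  obtain ⟨n, hn⟩ := Finset.one_le_card.mp (by unfold smoothCountAP at h1; exact h1)
  simp only [Finset.mem_filter, Finset.mem_Icc] at hn
  exact ⟨n, hn.1.1, hn.2.1, hn.2.2⟩


/-! ### Appended: under `UnboundedSiegelZeros` the phenomenon recurs at arbitrarily large moduli -/

/-- **`UnboundedSiegelZeros` ⇒ Vinogradov's phenomenon at arbitrarily large moduli** (PROVED modulo
the WITHDRAWN sign-free transcription of Theorem 1.4; ERRATUM 2026-08-27: statement of record
`exists_smooth_in_class_frequently_of_unboundedSiegelZeros'`, binder `0 < y`; this one is kept valid and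
unchanged — note that its hypotheses `h14 ∧ hU` are jointly CONTRADICTORY by
`not_unboundedSiegelZeros_of_theorem14`, which is exactly why the unprimed fact was withdrawn): if
Siegel zeros of arbitrarily large quality exist at arbitrarily large conductors (the
tree's open hypothesis `UnboundedSiegelZeros`), then for every `A > 0` and every `X` there is a modulus
`q ≥ X` such that for every `y` with `q ≤ y^A` every reduced residue class mod `q` contains a `y`-smooth
number (and (1.1) holds for all these `(q, y, a)`). [cite: BanksShparlinski2022Soundararajan, §1.2 Theorem 1.4 and Corollary 1.5]
[cite: TaoTeravainen2021, Definition 1.4] -/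
theorem exists_smooth_in_class_frequently_of_unboundedSiegelZeros (h14 : banksShparlinski2022_theorem14)
    (hU : Summit.Parity.GeneralizedHardyLittlewood.UnboundedSiegelZeros) {A : ℝ} (hA : 0 < A) (X : ℕ) :
    ∃ (q : ℕ) (_ : NeZero q), X ≤ q ∧
      ∀ y : ℝ, (q : ℝ) ≤ y ^ A → ∀ a : ℤ, Int.gcd a q = 1 →
        Prediction y q a ∧
          ∃ n : ℕ, 1 ≤ n ∧ n ∈ Nat.smoothNumbers (⌊y⌋₊ + 1) ∧ ((n : ℤ) : ZMod q) = (a : ZMod q) := by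
  obtain ⟨Q, hQ, H⟩ := exists_smooth_in_class_of_isSiegelZero h14 hA
  obtain ⟨Q', hQ', H'⟩ := prediction_of_isSiegelZero h14 hA
  -- a Siegel zero of quality `≥ 4 max(Q,Q')` at a conductor `≥ max(X, ⌈Q⌉+1, ⌈Q'⌉+1, 3)`
  obtain ⟨q, hq0, χ, η, hq, hη, hS⟩ :=
    hU (4 * max Q Q') (max X (max (⌈Q⌉₊ + 1) (max (⌈Q'⌉₊ + 1) 3)))
  haveI := hq0
  have hX : X ≤ q := le_trans (le_max_left _ _) hq
  have hqQ : Q < q := by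
    have h1 : ⌈Q⌉₊ + 1 ≤ q := le_trans (le_trans (le_max_left _ _) (le_max_right _ _)) hq
    have h2 : Q ≤ ⌈Q⌉₊ := Nat.le_ceil Q
    have h3 : ((⌈Q⌉₊ + 1 : ℕ) : ℝ) ≤ q := by exact_mod_cast h1
    push_cast at h3
    linarith
  have hqQ' : Q' < q := by
    have h1 : ⌈Q'⌉₊ + 1 ≤ q :=
      le_trans (le_trans (le_trans (le_max_left _ _) (le_max_right _ _)) (le_max_right _ _)) hq
    have h2 : Q' ≤ ⌈Q'⌉₊ := Nat.le_ceil Q'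
    have h3 : ((⌈Q'⌉₊ + 1 : ℕ) : ℝ) ≤ q := by exact_mod_cast h1
    push_cast at h3
    linarith
  have hq3 : 3 ≤ q :=
    le_trans (le_trans (le_trans (le_max_right _ _) (le_max_right _ _)) (le_max_right _ _)) hq
  have hηQ : 4 * Q ≤ η := le_trans (by nlinarith [le_max_left Q Q', hQ.le]) hη
  have hηQ' : 4 * Q' ≤ η := le_trans (by nlinarith [le_max_right Q Q', hQ'.le]) hη
  refine ⟨q, hq0, hX, fun y hy a ha => ⟨H' q hqQ' hq3 χ η hS hηQ' y hy a ha, ?_⟩⟩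
  exact H q hqQ hq3 χ η hS hηQ y hy a ha


/-! ### Appended 2026-08-27 (ERRATUM): kernel witnesses of the junk branch of the withdrawn
sign-free declarations -/

/-- For `y < 2` the only `y`-smooth number is `1`: membership in `Nat.smoothNumbers (⌊y⌋₊ + 1)` forces
`n = 1` (`⌊y⌋₊ + 1 ≤ 2`, so `n ≠ 0` has no prime factor). In particular this covers every `y ≤ 0`, where
`⌊y⌋₊ = 0`. [cite: BanksShparlinski2022Soundararajan, §1.1 (definition of y-smooth: P(n) ≤ y, P(1) = 1)] -/
theorem eq_one_of_mem_smoothNumbers_of_lt_two {y : ℝ} (hy : y < 2) {n : ℕ}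
    (hn : n ∈ Nat.smoothNumbers (⌊y⌋₊ + 1)) : n = 1 := by
  have hfl : ⌊y⌋₊ < 2 := (Nat.floor_lt' (by norm_num)).mpr (by exact_mod_cast hy)
  by_contra h1
  obtain ⟨p, hp, hpn⟩ := Nat.exists_prime_and_dvd h1
  have hlt := (Nat.mem_smoothNumbers'.mp hn) p hp hpn
  have h2 := hp.two_le
  omega

/-- **Degenerate-branch witness.** If `y < 2` (so `n = 1` is the only `y`-smooth number) and
`φ(q) ≥ 2`, then the asymptotic (1.1) FAILS for every class `a`: for `x ≥ 1`, `Ψ_q(x,y) = 1` while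
`Ψ(x,y;q,a) ∈ {0, 1}`, and neither `|0 − 1/φ(q)|` nor `|1 − 1/φ(q)|` is `≤ (1/4)·(1/φ(q))`. (For `y > 0`
this is harmless in Theorem 1.4 — `Q_A ≥ 2^A` excludes `q ≤ y^A < 2^A` — but for `y = −q` the
hypothesis `q ≤ y^A` of the sign-free transcription is met at `A = 2`.)
[cite: BanksShparlinski2022Soundararajan, §1.1 (1.1)] -/
theorem not_prediction_of_lt_two {y : ℝ} (hy : y < 2) {q : ℕ} (hq : 2 ≤ Nat.totient q) (a : ℤ) :
    ¬ Prediction y q a := by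
  intro hP
  obtain ⟨x₀, hx₀⟩ := hP (1 / 4) (by norm_num)
  have hx1 : (1 : ℝ) ≤ max x₀ 1 := le_max_right _ _
  have h := hx₀ (max x₀ 1) (le_max_left _ _)
  -- `Ψ_q(x, y) = 1`
  have hcop : smoothCountCoprime (max x₀ 1) y q = 1 := by
    unfold smoothCountCoprime
    rw [Finset.card_eq_one]
    refine ⟨1, ?_⟩
    ext n
    simp only [Finset.mem_filter, Finset.mem_Icc, Finset.mem_singleton]
    constructor
    · rintro ⟨-, hn, -⟩
      exact eq_one_of_mem_smoothNumbers_of_lt_two hy hn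
    · rintro rfl
      refine ⟨⟨le_rfl, (Nat.one_le_floor_iff _).mpr hx1⟩, ?_, Nat.coprime_one_left _⟩
      rw [Nat.mem_smoothNumbers]
      exact ⟨one_ne_zero, by simp⟩
  -- `Ψ(x, y; q, a) ≤ 1`
  have hAP : smoothCountAP (max x₀ 1) y q a ≤ 1 := by
    unfold smoothCountAP
    calc _ ≤ ({1} : Finset ℕ).card := Finset.card_le_card (fun n hn => by
            simp only [Finset.mem_filter] at hn
            simp [eq_one_of_mem_smoothNumbers_of_lt_two hy hn.2.1])
      _ = 1 := rfl
  have hφ : (2 : ℝ) ≤ (Nat.totient q : ℝ) := by exact_mod_cast hq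
  have hφinv : 1 / (Nat.totient q : ℝ) ≤ 1 / 2 := one_div_le_one_div_of_le (by norm_num) hφ
  have hφinv0 : 0 < 1 / (Nat.totient q : ℝ) := by positivity
  rw [hcop] at h
  rcases (show smoothCountAP (max x₀ 1) y q a = 0 ∨ smoothCountAP (max x₀ 1) y q a = 1 by omega)
    with h0 | h1
  · rw [h0] at h
    simp only [Nat.cast_zero, Nat.cast_one, one_div, zero_sub, abs_neg] at h
    rw [abs_of_pos (by positivity)] at h
    have : (0 : ℝ) < (Nat.totient q : ℝ)⁻¹ := by positivity
    linarith
  · rw [h1] at h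
    simp only [Nat.cast_one, one_div] at h
    rw [one_div] at hφinv hφinv0
    rw [abs_of_nonneg (by linarith)] at h
    linarith

/-- **The withdrawn sign-free `SoundHypothesis 𝒬` is false for every unbounded `𝒬`** (whereas the source
PROVES its `SC(𝒬)` for the infinite sets of Corollaries 1.2 and 1.5): take `A = 2`, `q ∈ 𝒬` beyond
`Q₀` and `3`, `y = −q` (`(−q)^2 = q²`), `a = 1`. [cite: BanksShparlinski2022Soundararajan, §1.1 Hypothesis SC(𝒬) and Corollaries 1.2, 1.5] -/
theorem not_soundHypothesis_of_unbounded {𝒬 : Set ℕ} (h𝒬 : ∀ N : ℕ, ∃ q ∈ 𝒬, N ≤ q) :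
    ¬ SoundHypothesis 𝒬 := by
  intro hS
  obtain ⟨Q₀, H⟩ := hS 2 two_pos
  obtain ⟨q, hq𝒬, hq⟩ := h𝒬 (max (⌈Q₀⌉₊ + 1) 3)
  have hq3 : 3 ≤ q := le_trans (le_max_right _ _) hq
  have hqQ : Q₀ < q := by
    have h1 : ⌈Q₀⌉₊ + 1 ≤ q := le_trans (le_max_left _ _) hq
    have h2 : Q₀ ≤ ⌈Q₀⌉₊ := Nat.le_ceil Q₀
    have h3 : ((⌈Q₀⌉₊ + 1 : ℕ) : ℝ) ≤ q := by exact_mod_cast h1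
    push_cast at h3
    linarith
  have hq3r : (3 : ℝ) ≤ q := by exact_mod_cast hq3
  have hy : (q : ℝ) ≤ (-(q : ℝ)) ^ (2 : ℝ) := by
    rw [Real.rpow_two, neg_sq]; nlinarith
  have hφ : 2 ≤ Nat.totient q := by
    have hev : Even (Nat.totient q) := Nat.totient_even (by omega)
    have hpos : 0 < Nat.totient q := Nat.totient_pos.mpr (by omega)
    obtain ⟨k, hk⟩ := hev
    omega
  exact not_prediction_of_lt_two (by linarith) hφ 1 (H q hq𝒬 hqQ (-(q : ℝ)) hy 1 (by simp [Int.gcd]))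

/-- **The withdrawn sign-free `banksShparlinski2022_theorem14` implies a UNIFORM zero-free region**
(the junk branch `y = −q`, `A = 2`, `a = 1`): some `Q > 0` such that for every `q > Q` with `φ(q) ≥ 2`
every zero `ρ ≠ 1` of every `L(s,χ)`, `χ` mod `q`, has `Re ρ ≤ 1 − 1/(Q log(q(|γ|+3)))` — an open
«no exceptional zero» statement the source never claims (referee probe `probe-p495459-negative-y.lean`,
V190). [cite: BanksShparlinski2022Soundararajan, §1.2 Theorem 1.4] -/
theorem zeroFree_of_theorem14 (h14 : banksShparlinski2022_theorem14) :
    ∃ Q : ℝ, 0 < Q ∧ ∀ (q : ℕ) [NeZero q], Q < q → 2 ≤ Nat.totient q →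
      ∀ (χ : DirichletCharacter ℂ q) (ρ : ℂ), ρ ≠ 1 → χ.LFunction ρ = 0 →
        ρ.re ≤ 1 - 1 / (Q * Real.log ((q : ℝ) * (|ρ.im| + 3))) := by
  obtain ⟨Q, hQ, H⟩ := h14 2 two_pos
  refine ⟨Q, hQ, fun q _ hqQ hφ χ ρ hρ1 hz => ?_⟩
  by_contra hlt
  push Not at hlt
  have hq1 : (1 : ℝ) ≤ q := by exact_mod_cast Nat.pos_of_ne_zero (NeZero.ne q)
  have hy : (q : ℝ) ≤ (-(q : ℝ)) ^ (2 : ℝ) := by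
    rw [Real.rpow_two, neg_sq]; nlinarith
  exact not_prediction_of_lt_two (by linarith) hφ 1
    (H q hqQ (-(q : ℝ)) hy 1 (by simp [Int.gcd]) ⟨χ, ρ, hρ1, hz, hlt⟩)

/-- **Hence the withdrawn sign-free fact refutes `UnboundedSiegelZeros`** (a Siegel zero of quality
`η ≥ 4Q` at a conductor `q > Q`, `q ≥ 3` feeds `prediction_of_isSiegelZero` with `y = −q`, `A = 2`,
`a = 1`, contradicting `not_prediction_of_lt_two`) — the kernel form of the director's finding «the named
FACT as typed is STRONGER THAN PRINT». [cite: BanksShparlinski2022Soundararajan, §1.2 Theorem 1.4]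
[cite: TaoTeravainen2021, Definition 1.4] -/
theorem not_unboundedSiegelZeros_of_theorem14 (h14 : banksShparlinski2022_theorem14) :
    ¬ Summit.Parity.GeneralizedHardyLittlewood.UnboundedSiegelZeros := by
  intro hU
  obtain ⟨Q, hQ, H⟩ := prediction_of_isSiegelZero h14 two_pos
  obtain ⟨q, hq0, χ, η, hq, hη, hS⟩ := hU (4 * Q) (max (⌈Q⌉₊ + 1) 3)
  haveI := hq0
  have hq3 : 3 ≤ q := le_trans (le_max_right _ _) hq
  have hqQ : Q < q := by
    have h1 : ⌈Q⌉₊ + 1 ≤ q := le_trans (le_max_left _ _) hq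
    have h2 : Q ≤ ⌈Q⌉₊ := Nat.le_ceil Q
    have h3 : ((⌈Q⌉₊ + 1 : ℕ) : ℝ) ≤ q := by exact_mod_cast h1
    push_cast at h3
    linarith
  have hq3r : (3 : ℝ) ≤ q := by exact_mod_cast hq3
  have hy : (q : ℝ) ≤ (-(q : ℝ)) ^ (2 : ℝ) := by
    rw [Real.rpow_two, neg_sq]; nlinarith
  have hφ : 2 ≤ Nat.totient q := by
    have hev : Even (Nat.totient q) := Nat.totient_even (by omega)
    have hpos : 0 < Nat.totient q := Nat.totient_pos.mpr (by omega)
    obtain ⟨k, hk⟩ := hev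
    omega
  exact not_prediction_of_lt_two (by linarith) hφ 1
    (H q hqQ hq3 χ η hS hη (-(q : ℝ)) hy 1 (by simp [Int.gcd]))


/-! ### Appended 2026-08-27 (ERRATUM): the consumers of record, over the primed fact
`banksShparlinski2022_theorem14'` (binder `0 < y`; proofs otherwise verbatim) -/

/-- **Corollary 1.5, DERIVED from Theorem 1.4 (statement of record).** If along `𝒬` each `q` carries a
character `χ_q` with a real zero `β_q < 1`, and `(1 − β_q) log q → 0` (`q → ∞`, `q ∈ 𝒬`; rendered
`∀ δ > 0, ∃ q₁, ∀ q ∈ 𝒬, q ≥ q₁ → (1 − β_q) log q ≤ δ`), then `SC(𝒬)` holds (`SoundHypothesis'`,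
binder `0 < y`). (For `q ≥ max(Q_A, q₁, 3)` with `δ = 1/(4Q_A)`: `1 − β_q ≤ δ/log q < 1/(Q_A log 3q)`.)
[cite: BanksShparlinski2022Soundararajan, §1.2 Corollary 1.5] -/
theorem corollary15_of_theorem14' (h14 : banksShparlinski2022_theorem14') (𝒬 : Set ℕ)
    (χ : ∀ q : ℕ, DirichletCharacter ℂ q) (β : ℕ → ℝ)
    (hzero : ∀ q ∈ 𝒬, ∀ _ : NeZero q, β q < 1 ∧ (χ q).LFunction (β q : ℂ) = 0)
    (hsmall : ∀ δ : ℝ, 0 < δ → ∃ q₁ : ℕ, ∀ q ∈ 𝒬, q₁ ≤ q → (1 - β q) * Real.log q ≤ δ) :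
    SoundHypothesis' 𝒬 := by
  intro A hA
  obtain ⟨Q, hQ, H⟩ := h14 A hA
  obtain ⟨q₁, hq₁⟩ := hsmall (1 / (4 * Q)) (by positivity)
  refine ⟨max Q (max (q₁ : ℝ) 3), fun q hq𝒬 hq y hy0 hy a ha => ?_⟩
  have hqQ : Q < q := lt_of_le_of_lt (le_max_left _ _) hq
  have hq1 : (q₁ : ℝ) < q := lt_of_le_of_lt (le_trans (le_max_left _ _) (le_max_right _ _)) hq
  have hq3 : (3 : ℝ) < q := lt_of_le_of_lt (le_trans (le_max_right _ _) (le_max_right _ _)) hq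
  have hq1' : q₁ ≤ q := by exact_mod_cast hq1.le
  haveI : NeZero q := ⟨by rintro rfl; norm_num at hq3⟩
  obtain ⟨hβ1, hz⟩ := hzero q hq𝒬 inferInstance
  have hδ := hq₁ q hq𝒬 hq1'
  refine H q hqQ y hy0 hy a ha ⟨χ q, (β q : ℂ), ?_, hz, ?_⟩
  · intro h1
    have := congrArg Complex.re h1
    simp at this
    linarith
  · -- `1 − 1/(Q log(3q)) < β_q`
    simp only [Complex.ofReal_im, abs_zero, zero_add, Complex.ofReal_re]
    have hq0 : (0 : ℝ) < q := by linarith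
    have hlogq : 1 < Real.log (q : ℝ) := by
      have h9 := Real.exp_one_lt_d9
      rw [Real.lt_log_iff_exp_lt hq0]; linarith
    have hlog3q : Real.log ((q : ℝ) * 3) ≤ 2 * Real.log q := by
      rw [Real.log_mul hq0.ne' (by norm_num)]
      have : Real.log (3 : ℝ) ≤ Real.log q := Real.log_le_log (by norm_num) hq3.le
      linarith
    have hlog3q0 : 0 < Real.log ((q : ℝ) * 3) := by
      rw [Real.log_mul hq0.ne' (by norm_num)]
      have : 0 < Real.log (3 : ℝ) := Real.log_pos (by norm_num)
      linarith
    have h1 : 1 - β q ≤ 1 / (4 * Q) / Real.log q := by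
      rw [le_div_iff₀ (by linarith)]; exact hδ
    have h2 : 1 / (4 * Q) / Real.log q < 1 / (Q * Real.log ((q : ℝ) * 3)) := by
      rw [div_div, div_lt_div_iff₀ (by positivity) (by positivity)]
      nlinarith
    linarith

/-- **A Siegel zero of quality `≥ 4Q_A` triggers Theorem 1.4 (statement of record).** For every `A > 0`
there is `Q_A > 0` such that a Tao–Teräväinen Siegel zero of quality `η ≥ 4Q_A` attached to `χ` mod
`q > Q_A`, `q ≥ 3` gives (1.1) for every `y > 0` with `q ≤ y^A` and every reduced class `a`.
[cite: BanksShparlinski2022Soundararajan, §1.2 Theorem 1.4] [cite: TaoTeravainen2021, Definition 1.4] -/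
theorem prediction_of_isSiegelZero' (h14 : banksShparlinski2022_theorem14') {A : ℝ} (hA : 0 < A) :
    ∃ Q : ℝ, 0 < Q ∧ ∀ (q : ℕ) [NeZero q], Q < q → 3 ≤ q →
      ∀ (χ : DirichletCharacter ℂ q) (η : ℝ), IsSiegelZero χ η → 4 * Q ≤ η →
        ∀ y : ℝ, 0 < y → (q : ℝ) ≤ y ^ A → ∀ a : ℤ, Int.gcd a q = 1 → Prediction y q a := by
  obtain ⟨Q, hQ, H⟩ := h14 A hA
  refine ⟨Q, hQ, fun q _ hqQ hq3 χ η hS hη y hy0 hy a ha => ?_⟩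
  obtain ⟨hprim, hquad, h10, hzero⟩ := hS
  have hq3r : (3 : ℝ) ≤ q := by exact_mod_cast hq3
  have hq0 : (0 : ℝ) < q := by linarith
  have hlogq : 1 < Real.log (q : ℝ) := by
    have h9 := Real.exp_one_lt_d9
    rw [Real.lt_log_iff_exp_lt hq0]; linarith
  have hηpos : 0 < η := by linarith
  refine H q hqQ y hy0 hy a ha ⟨χ, ((1 - 1 / (η * Real.log q) : ℝ) : ℂ), ?_, hzero, ?_⟩
  · intro h1
    have := congrArg Complex.re h1
    simp only [Complex.ofReal_re, Complex.one_re] at this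
    have : 1 / (η * Real.log q) = 0 := by linarith
    rw [div_eq_zero_iff] at this
    rcases this with h | h
    · norm_num at h
    · have : 0 < η * Real.log q := by positivity
      linarith
  · simp only [Complex.ofReal_im, abs_zero, zero_add, Complex.ofReal_re]
    have hlog3q : Real.log ((q : ℝ) * 3) ≤ 2 * Real.log q := by
      rw [Real.log_mul hq0.ne' (by norm_num)]
      have : Real.log (3 : ℝ) ≤ Real.log q := Real.log_le_log (by norm_num) hq3r
      linarith
    have hlog3q0 : 0 < Real.log ((q : ℝ) * 3) := by
      rw [Real.log_mul hq0.ne' (by norm_num)]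
      have : 0 < Real.log (3 : ℝ) := Real.log_pos (by norm_num)
      linarith
    have h1 : 1 / (η * Real.log q) ≤ 1 / (4 * Q * Real.log q) :=
      div_le_div_of_nonneg_left zero_le_one (by positivity)
        (mul_le_mul_of_nonneg_right hη (by linarith))
    have h2 : 1 / (4 * Q * Real.log q) < 1 / (Q * Real.log ((q : ℝ) * 3)) := by
      rw [div_lt_div_iff₀ (by positivity) (by positivity)]
      nlinarith
    linarith

/-- **The illusory-world headline over the statement of record** (PROVED modulo Theorem 1.4): for every
`A > 0` there is `Q_A > 0` such that, if `χ` mod `q` (`q > Q_A`, `q ≥ 3`) carries a Tao–Teräväinen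
Siegel zero of quality `η ≥ 4Q_A`, then for every `y > 0` with `q ≤ y^A` (i.e. `y ≥ q^{1/A}`) EVERY
reduced residue class `a mod q` contains `y`-smooth numbers.
[cite: BanksShparlinski2022Soundararajan, §1.2 Theorem 1.4 and §1.1 (Granville's remark on the least quadratic non-residue)]
[cite: TaoTeravainen2021, Definition 1.4] -/
theorem exists_smooth_in_class_of_isSiegelZero' (h14 : banksShparlinski2022_theorem14') {A : ℝ}
    (hA : 0 < A) :
    ∃ Q : ℝ, 0 < Q ∧ ∀ (q : ℕ) [NeZero q], Q < q → 3 ≤ q →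
      ∀ (χ : DirichletCharacter ℂ q) (η : ℝ), IsSiegelZero χ η → 4 * Q ≤ η →
        ∀ y : ℝ, 0 < y → (q : ℝ) ≤ y ^ A → ∀ a : ℤ, Int.gcd a q = 1 →
          ∃ n : ℕ, 1 ≤ n ∧ n ∈ Nat.smoothNumbers (⌊y⌋₊ + 1) ∧ ((n : ℤ) : ZMod q) = (a : ZMod q) := by
  obtain ⟨Q, hQ, H⟩ := prediction_of_isSiegelZero' h14 hA
  refine ⟨Q, hQ, fun q _ hqQ hq3 χ η hS hη y hy0 hy a ha => ?_⟩
  have hP := H q hqQ hq3 χ η hS hη y hy0 hy a ha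
  obtain ⟨x₀, hx₀⟩ := exists_smooth_in_class (by omega) hP
  have h1 := hx₀ x₀ le_rfl
  obtain ⟨n, hn⟩ := Finset.one_le_card.mp (by unfold smoothCountAP at h1; exact h1)
  simp only [Finset.mem_filter, Finset.mem_Icc] at hn
  exact ⟨n, hn.1.1, hn.2.1, hn.2.2⟩

/-- **`UnboundedSiegelZeros` ⇒ Vinogradov's phenomenon at arbitrarily large moduli, over the statement of
record** (PROVED modulo Theorem 1.4): if Siegel zeros of arbitrarily large quality exist at arbitrarily
large conductors, then for every `A > 0` and every `X` there is a modulus `q ≥ X` such that for every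
`y > 0` with `q ≤ y^A` every reduced residue class mod `q` contains a `y`-smooth number (and (1.1) holds
for all these `(q, y, a)`). [cite: BanksShparlinski2022Soundararajan, §1.2 Theorem 1.4 and Corollary 1.5]
[cite: TaoTeravainen2021, Definition 1.4] -/
theorem exists_smooth_in_class_frequently_of_unboundedSiegelZeros'
    (h14 : banksShparlinski2022_theorem14') (hU : Summit.Parity.GeneralizedHardyLittlewood.UnboundedSiegelZeros) {A : ℝ} (hA : 0 < A) (X : ℕ) :
    ∃ (q : ℕ) (_ : NeZero q), X ≤ q ∧
      ∀ y : ℝ, 0 < y → (q : ℝ) ≤ y ^ A → ∀ a : ℤ, Int.gcd a q = 1 →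
        Prediction y q a ∧
          ∃ n : ℕ, 1 ≤ n ∧ n ∈ Nat.smoothNumbers (⌊y⌋₊ + 1) ∧ ((n : ℤ) : ZMod q) = (a : ZMod q) := by
  obtain ⟨Q, hQ, H⟩ := exists_smooth_in_class_of_isSiegelZero' h14 hA
  obtain ⟨Q', hQ', H'⟩ := prediction_of_isSiegelZero' h14 hA
  -- a Siegel zero of quality `≥ 4 max(Q,Q')` at a conductor `≥ max(X, ⌈Q⌉+1, ⌈Q'⌉+1, 3)`
  obtain ⟨q, hq0, χ, η, hq, hη, hS⟩ :=
    hU (4 * max Q Q') (max X (max (⌈Q⌉₊ + 1) (max (⌈Q'⌉₊ + 1) 3)))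
  haveI := hq0
  have hX : X ≤ q := le_trans (le_max_left _ _) hq
  have hqQ : Q < q := by
    have h1 : ⌈Q⌉₊ + 1 ≤ q := le_trans (le_trans (le_max_left _ _) (le_max_right _ _)) hq
    have h2 : Q ≤ ⌈Q⌉₊ := Nat.le_ceil Q
    have h3 : ((⌈Q⌉₊ + 1 : ℕ) : ℝ) ≤ q := by exact_mod_cast h1
    push_cast at h3
    linarith
  have hqQ' : Q' < q := by
    have h1 : ⌈Q'⌉₊ + 1 ≤ q :=
      le_trans (le_trans (le_trans (le_max_left _ _) (le_max_right _ _)) (le_max_right _ _)) hq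
    have h2 : Q' ≤ ⌈Q'⌉₊ := Nat.le_ceil Q'
    have h3 : ((⌈Q'⌉₊ + 1 : ℕ) : ℝ) ≤ q := by exact_mod_cast h1
    push_cast at h3
    linarith
  have hq3 : 3 ≤ q :=
    le_trans (le_trans (le_trans (le_max_right _ _) (le_max_right _ _)) (le_max_right _ _)) hq
  have hηQ : 4 * Q ≤ η := le_trans (by nlinarith [le_max_left Q Q', hQ.le]) hη
  have hηQ' : 4 * Q' ≤ η := le_trans (by nlinarith [le_max_right Q Q', hQ'.le]) hη
  refine ⟨q, hq0, hX, fun y hy0 hy a ha => ⟨H' q hqQ' hq3 χ η hS hηQ' y hy0 hy a ha, ?_⟩⟩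
  exact H q hqQ hq3 χ η hS hηQ y hy0 hy a ha

end BanksShparlinski2022

/-! ### Appended 2026-08-27 (rc-cond g9; theory 05:04:07Z, CONSUMERS-side reading of I.19): the zero
hypothesis of Theorem 1.4 is VOID on a certified exception-free range

Theorem 1.4's trigger is a zero `β + iγ` of some `L(s,χ)`, `χ` mod `q` — ANY character, real or
complex zero — with `β > 1 − 1/(Q_A log(q(|γ|+3)))`. The wide criterion `NoRealZeroUpTo Q` alone
(real zeros of real characters) does not void it; McCurley's at-most-one-zero theorem
(`McCurley1984_theorem1`, `R = 9.645908801`, region `σ > 1 − 1/(R log max(q, q|t|, 10))`) turns the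
table into an exception-free region `ZeroFreeRegionUpTo Q 10 10` (`zeroFreeRegionUpTo_of_noExceptionalZeroUpTo`),
and since `max(q, q|γ|, 10) ≤ q(|γ|+3)` for `q ≥ 4`, the Banks–Shparlinski region at any level
`Q_A ≥ 10` lies inside McCurley's. The level may be normalised upward for free
(`theorem14'_level_mono`: the fact at level `Q` implies it at every `Q' ≥ Q`), so on a certified range
`4 ≤ q ≤ Q` Theorem 1.4 — read at any level `≥ 10` — has an unmeetable hypothesis: the illusory world of
I.19 is switched OFF there, value-free until the leaf books (instances `10¹⁰`, `3·10¹⁰`). -/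

namespace BanksShparlinski2022

/-- **Level normalisation.** The statement of record is monotone in its level: if Theorem 1.4 holds
with `Q_A = Q` it holds with any `Q' ≥ Q` (fewer moduli, narrower zero region — `log(q(|γ|+3)) > 0`).
Hence `Q_A` may be assumed as large as convenient (e.g. `≥ 10`, McCurley's constant rounded up).
[cite: BanksShparlinski2022Soundararajan, §1.2 Theorem 1.4 ("there is a number Q_A > 0")] -/
theorem theorem14'_level_mono (h14 : banksShparlinski2022_theorem14') {A : ℝ} (hA : 0 < A) (Q₁ : ℝ) :
    ∃ Q : ℝ, Q₁ ≤ Q ∧ 0 < Q ∧ ∀ (q : ℕ) [NeZero q], Q < q →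
      ∀ y : ℝ, 0 < y → (q : ℝ) ≤ y ^ A → ∀ a : ℤ, Int.gcd a q = 1 →
        (∃ (χ : DirichletCharacter ℂ q) (ρ : ℂ), ρ ≠ 1 ∧ χ.LFunction ρ = 0 ∧
            1 - 1 / (Q * Real.log ((q : ℝ) * (|ρ.im| + 3))) < ρ.re) →
          Prediction y q a := by
  obtain ⟨Q, hQ, H⟩ := h14 A hA
  refine ⟨max Q Q₁, le_max_right _ _, lt_of_lt_of_le hQ (le_max_left _ _),
    fun q _ hq y hy0 hy a ha hz => ?_⟩
  obtain ⟨χ, ρ, hρ1, hzero, hre⟩ := hz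
  have hqQ : Q < q := lt_of_le_of_lt (le_max_left _ _) hq
  refine H q hqQ y hy0 hy a ha ⟨χ, ρ, hρ1, hzero, lt_of_le_of_lt ?_ hre⟩
  -- `1 − 1/(Q log L) ≤ 1 − 1/(max Q Q₁ · log L)` with `L = q(|γ|+3) ≥ 3`
  have hq1 : (1 : ℝ) ≤ q := by exact_mod_cast Nat.one_le_iff_ne_zero.mpr (NeZero.ne q)
  have hL : 1 < (q : ℝ) * (|ρ.im| + 3) := by nlinarith [abs_nonneg ρ.im]
  have hlog : 0 < Real.log ((q : ℝ) * (|ρ.im| + 3)) := Real.log_pos hL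
  have h1 : 1 / (max Q Q₁ * Real.log ((q : ℝ) * (|ρ.im| + 3))) ≤
      1 / (Q * Real.log ((q : ℝ) * (|ρ.im| + 3))) :=
    one_div_le_one_div_of_le (mul_pos hQ hlog)
      (mul_le_mul_of_nonneg_right (le_max_left _ _) hlog.le)
  linarith

/-- **The zero hypothesis of Theorem 1.4 inside an exception-free region.** Under
`ZeroFreeRegionUpTo Qc R M₀` (`R > 0`, floor `M₀ ≤ 12`): for every level `Q ≥ R`, every modulus
`4 ≤ q ≤ Qc`, every `χ` mod `q` and every zero `ρ ≠ 1` of `L(s,χ)`,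
`Re ρ ≤ 1 − 1/(Q log(q(|Im ρ|+3)))` — i.e. NO character mod `q` meets Theorem 1.4's hypothesis at
level `Q` (because `max(q, q|γ|, M₀) ≤ q(|γ|+3)`, so the Banks–Shparlinski region lies inside the
certified one). [cite: BanksShparlinski2022Soundararajan, §1.2 Theorem 1.4 (the zero hypothesis)]
[cite: McCurley1984ZFR, Theorem 1 (nonexceptional moduli)] -/
theorem zeroHypothesis_false_of_zeroFreeRegionUpTo {Qc : ℕ} {R M₀ : ℝ}
    (hZ : ZeroFreeRegionUpTo Qc R M₀) (hR : 0 < R) (hM : M₀ ≤ 12) {Q : ℝ} (hQ : R ≤ Q)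
    {q : ℕ} [NeZero q] (h4 : 4 ≤ q) (hq : q ≤ Qc) (χ : DirichletCharacter ℂ q) {ρ : ℂ}
    (hρ : ρ ≠ 1) (hz : χ.LFunction ρ = 0) :
    ρ.re ≤ 1 - 1 / (Q * Real.log ((q : ℝ) * (|ρ.im| + 3))) := by
  by_contra hlt
  push Not at hlt
  have hq4 : (4 : ℝ) ≤ q := by exact_mod_cast h4
  set M : ℝ := max (max (q : ℝ) ((q : ℝ) * |ρ.im|)) M₀ with hMdef
  have hγ : 0 ≤ |ρ.im| := abs_nonneg _
  -- `M ≤ q(|γ|+3)` and `M ≥ q ≥ 4`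
  have hML : M ≤ (q : ℝ) * (|ρ.im| + 3) := by
    have h0 : 0 ≤ (q : ℝ) * |ρ.im| := mul_nonneg (by linarith) hγ
    refine max_le (max_le ?_ ?_) ?_
    · nlinarith
    · nlinarith
    · nlinarith
  have hMq : (q : ℝ) ≤ M := le_trans (le_max_left _ _) (le_max_left _ _)
  have hM1 : 1 < M := by linarith
  have hlogM : 0 < Real.log M := Real.log_pos hM1
  have hlogL : Real.log M ≤ Real.log ((q : ℝ) * (|ρ.im| + 3)) :=
    Real.log_le_log (by linarith) hML
  -- `R log M ≤ Q log(q(|γ|+3))`, so the BS region is inside the certified one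
  have hRQ : R * Real.log M ≤ Q * Real.log ((q : ℝ) * (|ρ.im| + 3)) := by
    calc R * Real.log M ≤ Q * Real.log M := mul_le_mul_of_nonneg_right hQ hlogM.le
      _ ≤ Q * Real.log ((q : ℝ) * (|ρ.im| + 3)) :=
          mul_le_mul_of_nonneg_left hlogL (le_trans hR.le hQ)
  have h1 : 1 / (Q * Real.log ((q : ℝ) * (|ρ.im| + 3))) ≤ 1 / (R * Real.log M) :=
    one_div_le_one_div_of_le (mul_pos hR hlogM) hRQ
  have hregion : 1 - 1 / (R * Real.log M) < ρ.re := by linarith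
  exact hZ q (le_trans (by norm_num) h4) hq χ ρ hρ (by rw [hMdef] at hregion; exact hregion) hz

/-- **… on any certified table with McCurley's theorem.** Under `NoRealZeroUpTo Qc` (the cell's
wide criterion: no real zero in `(0,1)` for any real primitive `χ` of conductor `3 ≤ q ≤ Qc`) and
`McCurley1984_theorem1`: for every level `Q ≥ 10`, every `4 ≤ q ≤ Qc`, no `L(s,χ)`, `χ` mod `q`, has a
zero `ρ ≠ 1` with `Re ρ > 1 − 1/(Q log(q(|Im ρ|+3)))` (the table removes McCurley's possible
exception: `ZeroFreeRegionUpTo Qc 10 10`). [cite: McCurley1984ZFR, Theorem 1]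
[cite: BanksShparlinski2022Soundararajan, §1.2 Theorem 1.4 (the zero hypothesis)] -/
theorem zeroHypothesis_false_of_noRealZeroUpTo {Qc : ℕ} (hW : NoRealZeroUpTo Qc)
    (hMc : McCurley1984_theorem1) {Q : ℝ} (hQ : 10 ≤ Q) {q : ℕ} [NeZero q] (h4 : 4 ≤ q)
    (hq : q ≤ Qc) (χ : DirichletCharacter ℂ q) {ρ : ℂ} (hρ : ρ ≠ 1) (hz : χ.LFunction ρ = 0) :
    ρ.re ≤ 1 - 1 / (Q * Real.log ((q : ℝ) * (|ρ.im| + 3))) := by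
  have hN : NoExceptionalZeroUpTo Qc (1 / 10) := NoRealZeroUpTo.noExceptionalZeroUpTo hW (1 / 10)
  have hZ : ZeroFreeRegionUpTo Qc 10 10 :=
    zeroFreeRegionUpTo_of_noExceptionalZeroUpTo hMc (by norm_num) hN (by norm_num) (by norm_num)
      (by norm_num)
  exact zeroHypothesis_false_of_zeroFreeRegionUpTo hZ (by norm_num) (by norm_num) hQ h4 hq χ hρ hz

/-- **Theorem 1.4 is vacuous on a certified table (negated-existential form).** Under
`NoRealZeroUpTo Qc` and `McCurley1984_theorem1`, for every level `Q ≥ 10` and every modulus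
`4 ≤ q ≤ Qc` the hypothesis "some `L(s,χ)`, `χ` mod `q`, has a zero `ρ ≠ 1` with
`Re ρ > 1 − 1/(Q log(q(|Im ρ|+3)))`" of `banksShparlinski2022_theorem14'` is FALSE — the illusory
world of Theorem 1.4 is switched off below `Qc` (with `theorem14'_level_mono`, at every admissible
level). [cite: BanksShparlinski2022Soundararajan, §1.2 Theorem 1.4] [cite: McCurley1984ZFR, Theorem 1] -/
theorem not_zeroHypothesis_of_noRealZeroUpTo {Qc : ℕ} (hW : NoRealZeroUpTo Qc)
    (hMc : McCurley1984_theorem1) {Q : ℝ} (hQ : 10 ≤ Q) {q : ℕ} [NeZero q] (h4 : 4 ≤ q)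
    (hq : q ≤ Qc) :
    ¬ ∃ (χ : DirichletCharacter ℂ q) (ρ : ℂ), ρ ≠ 1 ∧ χ.LFunction ρ = 0 ∧
        1 - 1 / (Q * Real.log ((q : ℝ) * (|ρ.im| + 3))) < ρ.re := by
  rintro ⟨χ, ρ, hρ, hz, hre⟩
  have := zeroHypothesis_false_of_noRealZeroUpTo hW hMc hQ h4 hq χ hρ hz
  linarith

/-- **Instance `Qc = 10¹⁰`** (leaf `NoRealZeroUpTo_1e10`, SWEEP-BOARD decade, BOOKED; with
`McCurley1984_theorem1`): for `Q ≥ 10` and `4 ≤ q ≤ 10¹⁰`, no character mod `q` meets Theorem 1.4's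
zero hypothesis at level `Q`. [cite: McCurley1984ZFR, Theorem 1]
[cite: BanksShparlinski2022Soundararajan, §1.2 Theorem 1.4] -/
theorem not_zeroHypothesis_upTo_1e10_of_leaf (hW : NoRealZeroUpTo_1e10) (hMc : McCurley1984_theorem1)
    {Q : ℝ} (hQ : 10 ≤ Q) {q : ℕ} [NeZero q] (h4 : 4 ≤ q) (hq : q ≤ 10 ^ 10) :
    ¬ ∃ (χ : DirichletCharacter ℂ q) (ρ : ℂ), ρ ≠ 1 ∧ χ.LFunction ρ = 0 ∧
        1 - 1 / (Q * Real.log ((q : ℝ) * (|ρ.im| + 3))) < ρ.re :=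
  not_zeroHypothesis_of_noRealZeroUpTo hW hMc hQ h4 (by norm_num at hq ⊢; exact hq)

/-- **Instance `Qc = 3·10¹⁰`** (wide rung leaf `NoRealZeroUpTo_3e10` = odd rung F ∧ even rung G,
VALUE-FREE until both rungs book; with `McCurley1984_theorem1`): for `Q ≥ 10` and `4 ≤ q ≤ 3·10¹⁰`,
no character mod `q` meets Theorem 1.4's zero hypothesis at level `Q`. [cite: McCurley1984ZFR, Theorem 1]
[cite: BanksShparlinski2022Soundararajan, §1.2 Theorem 1.4] -/
theorem not_zeroHypothesis_upTo_3e10_of_leaf (hW : NoRealZeroUpTo_3e10) (hMc : McCurley1984_theorem1)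
    {Q : ℝ} (hQ : 10 ≤ Q) {q : ℕ} [NeZero q] (h4 : 4 ≤ q) (hq : q ≤ 3 * 10 ^ 10) :
    ¬ ∃ (χ : DirichletCharacter ℂ q) (ρ : ℂ), ρ ≠ 1 ∧ χ.LFunction ρ = 0 ∧
        1 - 1 / (Q * Real.log ((q : ℝ) * (|ρ.im| + 3))) < ρ.re :=
  not_zeroHypothesis_of_noRealZeroUpTo hW hMc hQ h4 (by norm_num at hq ⊢; exact hq)

end BanksShparlinski2022

end Literature.NumberTheory.LFunctions

end
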